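import Summits.CriticalPhenomena.SAWScalingLimit.Theorems.SAWRenewalTightnessStripMassConservation
import HarnessLib

/-!
# Line `kesten-product-renewal-dictionary` (crux stmt-CriticalPhenomena-7117): stub G — Kesten's
full factorisation of self-avoiding bridge words into irreducible bridges

Proof file for the registered stub `ms_irrFactorisation` of the line
`kesten-product-renewal-dictionary` for the crux `SAWTotalPositivity.CriticalBubbleBound`.

Word model of `SAWWords.lean` / `SAWWordBridges.lean` (`Step = Fin 4`, `IsSAW`, `IsBridgeW`,
`IsIrrBridge`). KESTEN'S FULL FACTORISATION (Madras–Slade §4.2, eq. (4.2.2); used in §8.1,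
(8.1.14)–(8.1.18)): every self-avoiding bridge word is UNIQUELY a concatenation
`s₁ ++ ⋯ ++ sₘ` of irreducible bridges (`m = 0` for the empty word), i.e. the concatenation map
`(m, (s₁, …, sₘ)) ↦ s₁ ++ ⋯ ++ sₘ` from `Σ m, (Fin m → {irreducible bridges})` is a bijection onto the
self-avoiding bridge words:

1. closure (`flatten_ofFn_saw_bridge`): a concatenation of irreducible bridges is a self-avoiding
   bridge word (`IsSAW.append_of_bridge`, `IsBridgeW.append`, induction on `m`);
2. injectivity (`flatten_ofFn_inj`): unique decoding of the first factor `eq_of_append_eq'`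
   (Kesten), then induction on `m`;
3. surjectivity (`exists_flatten_ofFn_eq`): cut a non-empty word at its least break point
   (`StripMass.exists_irrBridge_append`) and recurse on the (strictly shorter) bridge tail.

This makes every `x_c`-weighted sum over bridges an expectation for a renewal process with i.i.d.
irreducible-bridge steps.

Sources: H. Kesten, *On the number of self-avoiding walks*, J. Math. Phys. 4 (1963) 960–969, §4;
N. Madras, G. Slade, *The Self-Avoiding Walk* (1993), §4.2 (Definition 4.2.1, eq. (4.2.1)–(4.2.2)),
§8.1 (eq. (8.1.14)–(8.1.18)).
-/

noncomputable section

open Literature.Probability.LatticeModels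
open Literature.Probability.RandomPlanarGeometry Literature.Probability.RandomPlanarGeometry.SAW
open scoped ENNReal NNReal BigOperators
open Classical

namespace Summit.CriticalPhenomena.SAWScalingLimit.Theorems.CriticalBubbleBound.Kesten.MS

/-! ## Closure: concatenations of irreducible bridges are self-avoiding bridge words -/

/-- **Closure under concatenation**: the concatenation `s₀ ++ ⋯ ++ s_{m-1}` of an `m`-tuple of
irreducible bridges is a self-avoiding bridge word (induction on `m`: the empty word is a
self-avoiding bridge; `IsSAW.append_of_bridge`, `IsBridgeW.append`).
[cite: MadrasSlade1993, §1.2, eq. (1.2.15)] -/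
theorem flatten_ofFn_saw_bridge : ∀ (m : ℕ) (s : Fin m → {w : List Step // IsIrrBridge w}),
    IsSAW (List.ofFn (fun k => (s k).1)).flatten ∧
      IsBridgeW (List.ofFn (fun k => (s k).1)).flatten := by
  intro m
  induction m with
  | zero =>
    intro s
    rw [List.ofFn_zero, List.flatten_nil]
    exact ⟨isSAW_nil, isBridgeW_nil⟩
  | succ m ih =>
    intro s
    rw [List.ofFn_succ, List.flatten_cons]
    obtain ⟨h1, h2⟩ := ih (fun k => s k.succ)
    exact ⟨(s 0).2.saw.append_of_bridge h1 (s 0).2.bridge h2, (s 0).2.bridge.append h2⟩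

/-! ## Injectivity: unique decoding -/

/-- **Unique factorisation**: if two tuples of irreducible bridges have the same concatenation,
they are equal (as elements of `Σ m, (Fin m → _)`). Induction on the length of the first tuple:
an empty concatenation forces the other tuple to be empty (irreducible bridges are non-empty);
otherwise Kesten's unique decoding `eq_of_append_eq'` (the tails are bridges by
`flatten_ofFn_saw_bridge`) identifies the first factors and the tails.
[cite: Kesten1963SAW, §4] -/
theorem flatten_ofFn_inj : ∀ (m m' : ℕ) (f : Fin m → {w : List Step // IsIrrBridge w})
    (f' : Fin m' → {w : List Step // IsIrrBridge w}),
    (List.ofFn (fun k => (f k).1)).flatten = (List.ofFn (fun k => (f' k).1)).flatten →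
      (⟨m, f⟩ : Σ m : ℕ, (Fin m → {w : List Step // IsIrrBridge w})) = ⟨m', f'⟩ := by
  intro m
  induction m with
  | zero =>
    intro m' f f' h
    cases m' with
    | zero =>
      have hff : f = f' := funext fun k => k.elim0
      subst hff
      rfl
    | succ m' =>
      exfalso
      rw [List.ofFn_zero, List.flatten_nil, List.ofFn_succ, List.flatten_cons] at h
      exact (f' 0).2.ne_nil (List.append_eq_nil_iff.1 h.symm).1
  | succ m ih =>
    intro m' f f' h
    cases m' with
    | zero =>
      exfalso
      rw [List.ofFn_zero, List.flatten_nil, List.ofFn_succ, List.flatten_cons] at h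
      exact (f 0).2.ne_nil (List.append_eq_nil_iff.1 h).1
    | succ m' =>
      rw [List.ofFn_succ, List.flatten_cons, List.ofFn_succ, List.flatten_cons] at h
      have hb := (flatten_ofFn_saw_bridge m (fun k => f k.succ)).2
      have hb' := (flatten_ofFn_saw_bridge m' (fun k => f' k.succ)).2
      obtain ⟨h1, h2⟩ := eq_of_append_eq' (f 0).2 (f' 0).2 hb hb' h
      have htails := ih m' (fun k => f k.succ) (fun k => f' k.succ) h2
      obtain ⟨rfl, htail⟩ := Sigma.mk.inj_iff.1 htails
      have htail' := eq_of_heq htail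
      have h0 : f 0 = f' 0 := Subtype.ext h1
      have hff : f = f' := by
        funext k
        cases k using Fin.cases with
        | zero => exact h0
        | succ i => exact congrFun htail' i
      subst hff
      rfl

/-! ## Surjectivity: iterate the first-factor cut -/

/-- **Existence of the factorisation**: every self-avoiding bridge word is the concatenation of a
tuple of irreducible bridges. Strong induction on the length: the empty word is the empty
concatenation; a non-empty word is `s ++ t` with `s` an irreducible bridge (non-empty) and `t` a
(strictly shorter, self-avoiding) bridge word (`StripMass.exists_irrBridge_append`), factorised by
the induction hypothesis. [cite: MadrasSlade1993, §4.2, eq. (4.2.1)–(4.2.2)] -/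
theorem exists_flatten_ofFn_eq (n : ℕ) : ∀ w : List Step, w.length ≤ n → IsSAW w → IsBridgeW w →
    ∃ (m : ℕ) (f : Fin m → {w : List Step // IsIrrBridge w}),
      (List.ofFn (fun k => (f k).1)).flatten = w := by
  induction n with
  | zero =>
    intro w hw _ _
    obtain rfl : w = [] := List.eq_nil_of_length_eq_zero (Nat.le_zero.1 hw)
    exact ⟨0, Fin.elim0, by rw [List.ofFn_zero, List.flatten_nil]⟩
  | succ n ih =>
    intro w hw hs hb
    by_cases hne : w = []
    · subst hne
      exact ⟨0, Fin.elim0, by rw [List.ofFn_zero, List.flatten_nil]⟩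
    · obtain ⟨s, t, rfl, hsirr, ht⟩ := StripMass.exists_irrBridge_append hs hb hne
      have htsaw : IsSAW t := by
        have h := hs.drop s.length
        rwa [List.drop_left] at h
      have hslen : 0 < s.length := List.length_pos_iff.2 hsirr.ne_nil
      have htlen : t.length ≤ n := by
        rw [List.length_append] at hw
        omega
      obtain ⟨m, f, hf⟩ := ih t htlen htsaw ht
      refine ⟨m + 1, Fin.cons ⟨s, hsirr⟩ f, ?_⟩
      rw [List.ofFn_succ, List.flatten_cons, Fin.cons_zero]
      simp only [Fin.cons_succ]
      rw [hf]

/-! ## The registered stub -/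

/-- **Stub G of the line `kesten-product-renewal-dictionary`** (registered signature, verbatim):
KESTEN'S FULL FACTORISATION — (1) the concatenation of an `m`-tuple of irreducible bridges is a
self-avoiding bridge word; (2) the concatenation map from `Σ m, (Fin m → {irreducible bridges})` is
injective (unique decoding); (3) every self-avoiding bridge word is reached (`m = 0` for the empty
word). Hence the self-avoiding bridge words are in bijection with the finite sequences of
irreducible bridges, and critical bridge masses are renewal expectations.
[cite: MadrasSlade1993, §4.2, eq. (4.2.2)] -/
theorem ms_irrFactorisation : (∀ (m : ℕ) (s : Fin m → {w : List Step // IsIrrBridge w}), IsSAW (List.ofFn (fun k => (s k).1)).flatten ∧ IsBridgeW (List.ofFn (fun k => (s k).1)).flatten) ∧ Function.Injective (fun x : (Σ m : ℕ, (Fin m → {w : List Step // IsIrrBridge w})) => (List.ofFn (fun k => (x.2 k).1)).flatten) ∧ (∀ w : List Step, IsSAW w → IsBridgeW w → ∃ x : (Σ m : ℕ, (Fin m → {w : List Step // IsIrrBridge w})), (List.ofFn (fun k => (x.2 k).1)).flatten = w) := by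
  refine ⟨flatten_ofFn_saw_bridge, ?_, ?_⟩
  · rintro ⟨m, f⟩ ⟨m', f'⟩ h
    exact flatten_ofFn_inj m m' f f' h
  · intro w hs hb
    obtain ⟨m, f, hf⟩ := exists_flatten_ofFn_eq w.length w le_rfl hs hb
    exact ⟨⟨m, f⟩, hf⟩

end Summit.CriticalPhenomena.SAWScalingLimit.Theorems.CriticalBubbleBound.Kesten.MS

end
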